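import Literature.Analysis.PDE.NeumannHalfBallHigher
import Literature.Analysis.FunctionSpaces.SobolevSmoothUpToBoundaryFour
import Literature.Analysis.FunctionSpaces.SobolevNormSmoothMaps
import Literature.Analysis.Distribution.DivFormRegularity
import HarnessLib

/-!
# Weak solutions of the Neumann problem on a half-ball with locally smooth coefficients:
# globalisation of the coefficients and `C^k` representatives (dimension four)

Topic `Analysis/PDE`. Theorem file (no definitions, no named facts; everything proved), on the
discharge path of `Literature.Geometry.Riemannian.sharpLogSobolevAVR_four`: the step "the weak
solution read in a boundary chart is smooth up to the flat boundary" of the classical `L²` theory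
(Taylor, *PDE I*, Ch. 5 §7, Prop. 7.4 with Prop. 7.2; Evans, *PDE*, §6.3.2 Thm. 5 and §5.6.3), in the
form the tree affords: a `C^k` representative for every `k`.

* `exists_contDiff_elliptic_extension` (**globalising the coefficients**): coefficients `A₀` smooth
  on `B(z,R₁)` and uniformly elliptic (constant `λ`) on `B̄(z,R₂)`, `r < R₂ < R₁`, agree on
  `B̄(z,r)` with GLOBALLY smooth, globally `λ`-elliptic coefficients
  `A = θ A₀ + (1 - θ) λ·id` (`θ` a bump, `≡ 1` on `B̄(z,r)`, supported in `B(z,R₂)`).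
* `isWeakNeumannHalfBall_of_local` : the data produced by a chart transfer — `u, ∇u ∈ L²(U_r)`,
  `⟪∇u, ·⟫` the weak derivative, and `∫_{U_r} ∂ζ(A₀ ∇u) = ∫_{U_r} F ζ` for `ζ ∈ C_c^∞(B(z,r))` —
  is a weak Neumann solution `IsWeakNeumannHalfBall volume ν z r A F 0 u ∇u` for the globalised `A`.
* `exists_contDiff_rep_of_weakNeumann_local_four` (**smooth representative**, `dim H = 4`): with
  `F` smooth on `B(z,R₁)`, for every `k` and every `0 < r' < r` there is `v ∈ C^k(H)` with `u = v`
  a.e. on `U_{r'}` (`memSobolevDomain_higher` for all orders, then the Morrey-based representative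
  `exists_contDiff_rep_of_memSobolevDomain_lipschitz_four` on the Lipschitz domain `U_{r'}`).

## References

* M. E. Taylor, *Partial Differential Equations I*, 2nd ed. (2011), Ch. 5 §7, Props. 7.2, 7.4.
  [TaylorPDEI2011]
* L. C. Evans, *Partial Differential Equations*, 2nd ed. (2010), §6.3.2 Thm. 5, §5.6.3. [Evans2010]
-/

noncomputable section

open MeasureTheory TopologicalSpace Set Function Filter Topology InnerProductSpace Metric
open scoped RealInnerProductSpace ENNReal NNReal ContDiff

namespace Literature.Analysis.PDE

open Literature.Analysis.FunctionSpaces Literature.Analysis.Distribution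

variable {H : Type*} [NormedAddCommGroup H] [InnerProductSpace ℝ H] [FiniteDimensional ℝ H]
  [MeasurableSpace H] [BorelSpace H]

omit [FiniteDimensional ℝ H] [MeasurableSpace H] [BorelSpace H] in
/-- A smooth cut-off times a map smooth on an open set containing the support of the cut-off is
smooth everywhere (vector-valued version of `contDiff_mul_of_tsupport_subset`). [folklore] -/
private theorem contDiff_smul_of_tsupport_subset_aux {W : Type*} [NormedAddCommGroup W]
    [NormedSpace ℝ W]
    {χ : H → ℝ} {g : H → W} {U : Set H} (hU : IsOpen U)
    (hχ : ContDiff ℝ ∞ χ) (hχU : tsupport χ ⊆ U) (hg : ContDiffOn ℝ ∞ g U) :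
    ContDiff ℝ ∞ fun x ↦ χ x • g x := by
  refine contDiff_iff_contDiffAt.2 fun x ↦ ?_
  by_cases hx : x ∈ U
  · exact hχ.contDiffAt.smul (hg.contDiffAt (hU.mem_nhds hx))
  · have hx' : x ∉ tsupport χ := fun h ↦ hx (hχU h)
    have hev : χ =ᶠ[𝓝 x] 0 := notMem_tsupport_iff_eventuallyEq.1 hx'
    have hev' : (fun y ↦ χ y • g y) =ᶠ[𝓝 x] fun _ ↦ 0 := by
      filter_upwards [hev] with y hy
      rw [hy, Pi.zero_apply, zero_smul]
    exact (contDiffAt_const (c := (0 : W))).congr_of_eventuallyEq hev'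

omit [MeasurableSpace H] [BorelSpace H] in
/-- **Globalising locally smooth, locally elliptic coefficients** (standard cut-off device in the
boundary regularity theory, Evans §6.3.2): `A = θ A₀ + (1 - θ) λ·id`. [folklore] -/
theorem exists_contDiff_elliptic_extension {A₀ : H → H →L[ℝ] H} {z : H} {r R₂ R₁ : ℝ}
    (hr : 0 < r) (hrR₂ : r < R₂) (hR₂R₁ : R₂ < R₁) (hA₀ : ContDiffOn ℝ ∞ A₀ (ball z R₁))
    {lam : ℝ} (hell : ∀ y ∈ closedBall z R₂, ∀ ξ : H, lam * ‖ξ‖ ^ 2 ≤ ⟪A₀ y ξ, ξ⟫) :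
    ∃ A : H → H →L[ℝ] H, ContDiff ℝ ∞ A ∧ (∀ y ∈ closedBall z r, A y = A₀ y) ∧
      ∀ (y : H) (ξ : H), lam * ‖ξ‖ ^ 2 ≤ ⟪A y ξ, ξ⟫ := by
  let θ : ContDiffBump z := ⟨r, R₂, hr, hrR₂⟩
  refine ⟨fun y ↦ θ y • A₀ y + (1 - θ y) • (lam • ContinuousLinearMap.id ℝ H), ?_, ?_, ?_⟩
  · refine (contDiff_smul_of_tsupport_subset_aux isOpen_ball θ.contDiff ?_ hA₀).add
      ((contDiff_const.sub θ.contDiff).smul contDiff_const)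
    exact θ.tsupport_eq.symm ▸ closedBall_subset_ball hR₂R₁
  · intro y hy
    show θ y • A₀ y + (1 - θ y) • (lam • ContinuousLinearMap.id ℝ H) = A₀ y
    rw [θ.one_of_mem_closedBall hy, one_smul, sub_self, zero_smul, add_zero]
  · intro y ξ
    have h0 : 0 ≤ θ y := θ.nonneg
    have h1 : θ y ≤ 1 := θ.le_one
    have hid : ⟪(lam • ContinuousLinearMap.id ℝ H) ξ, ξ⟫ = lam * ‖ξ‖ ^ 2 := by
      rw [FunLike.coe_smul, Pi.smul_apply, ContinuousLinearMap.id_apply,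
        real_inner_smul_left, real_inner_self_eq_norm_sq]
    show lam * ‖ξ‖ ^ 2 ≤ ⟪(θ y • A₀ y + (1 - θ y) • (lam • ContinuousLinearMap.id ℝ H)) ξ, ξ⟫
    rw [_root_.add_apply, FunLike.coe_smul, Pi.smul_apply,
      FunLike.coe_smul (1 - θ y), Pi.smul_apply, inner_add_left, real_inner_smul_left,
      real_inner_smul_left, hid]
    by_cases hy : y ∈ closedBall z R₂
    · have := hell y hy ξ
      nlinarith
    · have hθ0 : θ y = 0 := by
        refine θ.zero_of_le_dist (not_lt.1 fun h ↦ hy ?_)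
        exact mem_closedBall.2 h.le
      rw [hθ0]; simp

/-- The zero vector field lies in every `W^{k,2}(Ω; H)`. [folklore] -/
theorem memSobolevDomain_zero_fun (k : ℕ) (Ω : Opens H) (μ : Measure H) [μ.IsAddHaarMeasure] :
    MemSobolevDomain k 2 Ω μ (fun _ : H ↦ (0 : H)) := by
  induction k with
  | zero => rw [memSobolevDomain_zero_iff]; exact MemLp.zero' (ε := H)
  | succ k ih =>
    refine ⟨MemLp.zero' (ε := H), 0, ?_, fun w ↦ ?_⟩
    · have := HasWeakFDerivOn.of_contDiff_holds Ω μ (f := fun _ : H ↦ (0 : H)) contDiff_const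
      simpa using this
    · simpa using ih

/-- **The transferred weak solution is a weak Neumann solution on the half-ball** for the
globalised coefficients (flux `G = 0`). [cite: TaylorPDEI2011, Ch. 5 §7, (7.11)–(7.14)] -/
theorem isWeakNeumannHalfBall_of_local {ν z : H} {r : ℝ} {A₀ A : H → H →L[ℝ] H}
    (hAA₀ : ∀ y ∈ closedBall z r, A y = A₀ y) {F : H → ℝ} (hF : ContinuousOn F (closedBall z r))
    {u : H → ℝ} {gu : H → H} (hu : MemLp u 2 (volume.restrict (halfBall ν z r : Set H)))
    (hgu : MemLp gu 2 (volume.restrict (halfBall ν z r : Set H)))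
    (hW : HasWeakFDerivOn (halfBall ν z r) volume u (fun y ↦ innerSL ℝ (gu y)))
    (hweak : ∀ ζ : H → ℝ, ContDiff ℝ ∞ ζ → HasCompactSupport ζ → tsupport ζ ⊆ ball z r →
      ∫ y in (halfBall ν z r : Set H), fderiv ℝ ζ y (A₀ y (gu y)) =
        ∫ y in (halfBall ν z r : Set H), F y * ζ y) :
    IsWeakNeumannHalfBall volume ν z r A F (fun _ ↦ 0) u gu := by
  have hUm : MeasurableSet (halfBall ν z r : Set H) := (halfBall ν z r).isOpen.measurableSet
  refine ⟨hu, hgu, hW, ?_, memSobolevDomain_zero_fun 1 _ _, fun ζ hζ hζc hζt ↦ ?_⟩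
  · exact memLp_restrict_of_continuousOn_isCompact
      ((isCompact_closedBall z r).closure_of_subset
        (halfBall_subset_ball.trans ball_subset_closedBall))
      subset_closure (hF.mono (closure_minimal (halfBall_subset_ball.trans ball_subset_closedBall)
        isClosed_closedBall)) 2
  · rw [← setIntegral_congr_fun hUm fun y hy ↦ by
      rw [hAA₀ y (ball_subset_closedBall (halfBall_subset_ball hy))], hweak ζ hζ hζc hζt]
    refine setIntegral_congr_fun hUm fun y _ ↦ ?_
    rw [map_zero, add_zero]

/-- **`C^k` representatives of the weak Neumann solution near the flat boundary** (dimension four;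
Taylor, *PDE I*, Ch. 5 §7, Prop. 7.4 with Prop. 7.2 — `u ∈ H^{k+2}` for all `k` — and Sobolev
embedding): for the data of `isWeakNeumannHalfBall_of_local` with `A₀` smooth on `B(z,R₁)`,
`λ`-elliptic on `B̄(z,R₂)` (`r < R₂ < R₁`), and `F` smooth on `B(z,R₁)`, for every `k` and every
`0 < r' < r` there is `v ∈ C^k(H)` with `u = v` a.e. on `U_{r'}`.
[cite: TaylorPDEI2011, Ch. 5 §7, Proposition 7.4] -/
theorem exists_contDiff_rep_of_weakNeumann_local_four (hH : Module.finrank ℝ H = 4)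
    {ν z : H} (hν : ν ≠ 0) {r R₂ R₁ : ℝ} (hr : 0 < r) (hrR₂ : r < R₂) (hR₂R₁ : R₂ < R₁)
    {A₀ : H → H →L[ℝ] H} (hA₀ : ContDiffOn ℝ ∞ A₀ (ball z R₁))
    {lam : ℝ} (hlam : 0 < lam) (hell : ∀ y ∈ closedBall z R₂, ∀ ξ : H, lam * ‖ξ‖ ^ 2 ≤ ⟪A₀ y ξ, ξ⟫)
    {F : H → ℝ} (hF : ContDiffOn ℝ ∞ F (ball z R₁))
    {u : H → ℝ} {gu : H → H} (hu : MemLp u 2 (volume.restrict (halfBall ν z r : Set H)))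
    (hgu : MemLp gu 2 (volume.restrict (halfBall ν z r : Set H)))
    (hW : HasWeakFDerivOn (halfBall ν z r) volume u (fun y ↦ innerSL ℝ (gu y)))
    (hweak : ∀ ζ : H → ℝ, ContDiff ℝ ∞ ζ → HasCompactSupport ζ → tsupport ζ ⊆ ball z r →
      ∫ y in (halfBall ν z r : Set H), fderiv ℝ ζ y (A₀ y (gu y)) =
        ∫ y in (halfBall ν z r : Set H), F y * ζ y) :
    ∃ A : H → H →L[ℝ] H, ContDiff ℝ ∞ A ∧ (∀ y ∈ closedBall z r, A y = A₀ y) ∧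
      (∀ (y : H) (ξ : H), lam * ‖ξ‖ ^ 2 ≤ ⟪A y ξ, ξ⟫) ∧
      IsWeakNeumannHalfBall volume ν z r A F (fun _ ↦ 0) u gu ∧
      ∀ (k : ℕ) (r' : ℝ), 0 < r' → r' < r →
        ∃ v : H → ℝ, ContDiff ℝ k v ∧ u =ᵐ[volume.restrict (halfBall ν z r' : Set H)] v := by
  obtain ⟨A, hA, hAA₀, hellA⟩ := exists_contDiff_elliptic_extension hr hrR₂ hR₂R₁ hA₀ hell
  have hFc : ContinuousOn F (closedBall z r) :=
    hF.continuousOn.mono ((closedBall_subset_ball (hrR₂.trans hR₂R₁)))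
  have hsol := isWeakNeumannHalfBall_of_local hAA₀ hFc hu hgu hW hweak
  refine ⟨A, hA, hAA₀, hellA, hsol, fun k r' hr' hr'r ↦ ?_⟩
  -- `F ∈ W^{j,2}(U_r)` for every `j`
  have hFk : ∀ j : ℕ, MemSobolevDomain j 2 (halfBall ν z r) volume F := fun j ↦ by
    refine memSobolevDomain_of_contDiffOn (C := ball z R₁) isOpen_ball.uniqueDiffOn ?_ ?_ 2 j hF
    · exact (isCompact_closedBall z r).closure_of_subset
        (halfBall_subset_ball.trans ball_subset_closedBall)
    · exact (closure_minimal (halfBall_subset_ball.trans ball_subset_closedBall)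
        isClosed_closedBall).trans (closedBall_subset_ball (hrR₂.trans hR₂R₁))
  -- `u ∈ W^{k+5,2}(U_{r'})`
  have hreg : MemSobolevDomain (k + 3 + 2) 2 (halfBall ν z r') volume u :=
    hsol.memSobolevDomain_higher hA hlam hellA hν (hFk (k + 3))
      (memSobolevDomain_zero_fun (k + 3 + 1) _ _) hr' hr'r
  have hreg' : MemSobolevDomain (k + 3) 2 (halfBall ν z r') volume u :=
    memSobolevDomain_of_le (by omega) hreg
  obtain ⟨v, hv, hvk⟩ := exists_contDiff_rep_of_memSobolevDomain_lipschitz_four hH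
    isLipschitzDomain_halfBall isBounded_halfBall k hreg'
  exact ⟨v, hvk, hv⟩

end Literature.Analysis.PDE

end
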